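import Summits.HodgeConjecture.HodgeConjecture.Theses.PadicSemiregularLift
import Summits.HodgeConjecture.HodgeConjecture.Theorems.FormalLiftingFromClassLifting.Negative.ProClassCorrectionStubs

/-!
# `PadicPridhamSemiregularity` (stmt-HodgeConjecture-13815) · Negative · `K₀(X₁) → K₀(X_k)` is injective

Companion of `Negative/StepDatumReduction.lean` (standing disprover, cycle 3; its docstring cites this
file): the kernel condition of the reduction `hasStepDatum_of_additivePackage` ("the `K₀`-factorised
`σᵢ ∘ Ob` kill `ker(K₀(X_{n+1}) → K₀(X_k))`") is AUTOMATIC at `n = 0`, because for `k` perfect the first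
inclusion of the `p`-adic tower `X_k ⟶ X₁ = 𝒳 ⊗ W/p` is an isomorphism (`W(k)/p = k`). The isomorphism
itself was landed meanwhile by the sibling disprover of P1a as
`FormalLiftingFromClassLifting.Negative.isIso_specialFibreToThickening_zero'`
(`Theorems/FormalLiftingFromClassLifting/Negative/ProClassCorrectionStubs.lean`); it is REUSED here (imported,
not re-declared), and only the two `K₀`-consequences are added. Resubmission of the cycle-3 proposal
p76528 (bounced by a gate restart, not on content) by refuter-cdisprove-stmt-HodgeConjecture-13815-g4-0.
-/

set_option linter.dupNamespace false

noncomputable section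

namespace Summit.HodgeConjecture.HodgeConjecture.Theorems.PadicPridhamSemiregularity.Negative

open CategoryTheory AlgebraicGeometry
open Literature.AlgebraicGeometry.KTheory Literature.AlgebraicGeometry.Motives
  Literature.AlgebraicGeometry.Motives.WittScheme
open Summit.HodgeConjecture.HodgeConjecture.Theorems.FormalLiftingFromClassLifting.Negative
  (isIso_specialFibreToThickening_zero')

universe u

/-- `K₀`-pull-back along an isomorphism of schemes is injective (functor laws of `KZero.map`).
[folklore] -/
theorem kZero_map_injective_of_isIso {Y Z : Scheme.{u}} (f : Y ⟶ Z) [IsIso f] :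
    Function.Injective (KZero.map f) := by
  intro a b h
  have key : ∀ x : KZero Z, KZero.map (inv f) (KZero.map f x) = x := fun x => by
    rw [← KZero.map_comp_apply, IsIso.inv_hom_id, KZero.map_id, AddMonoidHom.id_apply]
  rw [← key a, ← key b, h]

variable {p : ℕ} [Fact p.Prime] {k : Type} [Field k] [CharP k p] [PerfectRing k p]

/-- **`K₀(X₁) → K₀(X_k)` is injective** (`k` perfect): pull-back along the isomorphism
`specialFibreToThickening 𝒳 0 : X_k ⟶ X₁`. Hence `KernelVanishing` of the step-datum reduction holds at
`n = 0` for every obstruction map, and line B's `stub_firstStep` needs none of `H_tf`, projectivity,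
`p ≠ 2`, `d < p` (`Negative/StepDatumReduction.lean`). [folklore] -/
theorem kZero_map_specialFibreToThickening_zero_injective (𝒳 : SchemeOver (WittVector p k)) :
    Function.Injective (KZero.map (specialFibreToThickening 𝒳 0)) := by
  haveI := isIso_specialFibreToThickening_zero' 𝒳
  exact kZero_map_injective_of_isIso _

end Summit.HodgeConjecture.HodgeConjecture.Theorems.PadicPridhamSemiregularity.Negative

end
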